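import Summits.BirchSwinnertonDyer.BirchSwinnertonDyer.Theorems.PrintCf2SplitBadTwoRestrictedSelmerNoFiniteSubmoduleOfTwist
import Summits.BirchSwinnertonDyer.BirchSwinnertonDyer.Theorems.PrintCf2SplitBadTwoControlCokernelOfFrame
import HarnessLib

/-!
# Crux `PrintCf2.SplitBadTwoRankOneOfFacts` (stmt-BirchSwinnertonDyer-20368), road α (v10.2, stub S3c₂ verbatim) — WHERE B17 ENTERS:
# the `Γ`-Euler characteristic `n` of `𝔖_{v̄}(K*_∞, W*)` is SANDWICHED, `v₂ #𝔖_{v̄}(K, W*) − 1 ≤ n ≤ v₂ #𝔖_{v̄}(K, W*) + #T + 2`;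
# the UPPER bound is B17-FREE (and B15-free), only the LOWER bound uses «no nonzero finite `Λ`-submodule»

Cell `bsd-print-cf2`, EXTRA WIDTH seat `bsd-line-cf2-p1-w4` g8 (prover-bsd-line-cf2-p1-w4-g8-0); `--supports
stmt-BirchSwinnertonDyer-20368` (helper, Theses-free). HONEST FRAMING: nothing here closes the crux or a registered stub; BSD is
not proved by any of this; no summit statement is proved by this seat. No definition, no named fact, no `sorry`.

WHY. S3c₂ asserts an EQUALITY `n = ord₂ #Ш + ord₂ ∏c − 2 ord₂ #tors + 2ℓ + e_C` for the number `n = log₂ #𝔖^Γ − log₂ #𝔖_Γ`. -w7's four-index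
identity (p652120) reads `n + v₂ #𝔖_Γ + v₂ #ker = v₂ #𝔖_{v̄}(K, W*) + v₂ [𝔖^Γ : res 𝔖_{v̄}(K, W*)]`; every term is `≥ 0`, so:
* the INEQUALITY `n ≤ v₂ #𝔖_{v̄}(K, W*) + v₂ [coker]` holds with NO hypothesis on `𝔖_Γ` and NO hypothesis on the kernel — and with -w3 g7's
  class bound (p66xxxx `padicValNat_two_relIndex_control_of_frame_le`: `v₂ [coker] ≤ #T + 2`, `T` = places of `K` above the odd part of `7d`)
  it is CLASS-UNIFORM: this is the direction that feeds the LOWER half of the crux (child 27851 `SplitBadTwoLowerHalfOfFacts`,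
  `MissingLowerBoundAt`: `ord₂ #Ш_an ≤ ord₂ #Ш` — the analytic exponent `n` is bounded ABOVE by the algebraic side);
* the reverse inequality `v₂ #𝔖_{v̄}(K, W*) + v₂ [coker] ≤ n + v₂ #ker`, hence `v₂ #𝔖_{v̄}(K, W*) − 1 ≤ n` with LEAD's `v₂ #ker ≤ 1` (p656507), needs
  `#𝔖_Γ = 1`, i.e. brick B17 (in the form of file 1, p660647: ONE odd `u` with `u·conj_{γ'} − 1` onto `𝔖`) — the direction of the UPPER half
  (child 27850, `MissingUpperBoundAt`: `ord₂ #Ш ≤ ord₂ #Ш_an`, the Euler-system direction).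
So B17 (and the exactness of the dyadic/local kernels, B15) are inputs of ONE of the two halves only; the other half of S3c₂ is, after the
landed bricks, a statement about the bottom value `v₂ #𝔖_{v̄}(K, W*)` alone.

CONTENT. §1 generic (any `K`, `p`, `κ`, `γ`, `p`-primary `M` with open stabilisers, `𝔮`, dual datum `D` with `HasCharValuationAt n`):
`le_card_base_add_relIndex_of_hasCharValuationAt` (the B17-free inequality) and `card_base_add_relIndex_le_of_twistedCoinvariants` (the other
direction from the twisted surjectivity). §2 road α on every S3c₂ frame: `eulerChar_le_of_frame` (NO `√−7`, NO B17, NO kernel bound: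
`n ≤ v₂ #𝔖_{v̄}(K, W*) + v₂ [coker]`), **`eulerChar_le_card_base_add_card_add_two_of_frame`** (`n ≤ v₂ #𝔖_{v̄}(K, W*) + #T + 2` for `d` squarefree,
`K` imaginary quadratic — fed by -w3 g7's cokernel bound), **`card_base_le_eulerChar_add_one_of_frame_of_twistedCoinvariants`**
(`v₂ #𝔖_{v̄}(K, W*) ≤ n + 1` over `K ∋ √−7`, GIVEN B17's twisted surjectivity), and the sandwich `eulerChar_sandwich_of_frame`.
presearch: Agboola 2007 §5–§6 (held); Greenberg LNM 1716 Lemma 4.2 — assembly of tree theorems only, no new fact.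

References: [Agboola2007] §5, §6, Prop. 8.1; [GreenbergLNM1716] §4 Lemma 4.2 (p. 102), Props. 4.14–4.15 (pp. 123–125).
-/

noncomputable section

open scoped Classical

set_option linter.dupNamespace false
set_option autoImplicit false

open NumberField IsDedekindDomain Field WeierstrassCurve
open Literature.NumberTheory.EllipticCurves Literature.NumberTheory.EllipticCurves.GreenbergSelmer
open Literature.NumberTheory.EllipticCurves.Agboola2007
open Literature.NumberTheory.EllipticCurves.IwasawaAlgebra
open Literature.NumberTheory.EllipticCurves.IwasawaDual
open Literature.NumberTheory.EllipticCurves.ResKernel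
open Literature.NumberTheory.GaloisRepresentations

universe u

namespace Summit.BirchSwinnertonDyer.BirchSwinnertonDyer.Theorems.PrintCf2.RestrictedSelmerPair

/-! ## §1. Generic: the two directions of the four-index identity -/

section Generic

variable {K : Type u} [Field K] [NumberField K] {p : ℕ} [Fact p.Prime] {κ : ZpExtension K p}
  {M : Type u} [AddCommGroup M] [DistribMulAction (absoluteGaloisGroup K) M] [TopologicalSpace M]
  [DiscreteTopology M] {𝔮 : HeightOneSpectrum (𝓞 K)} {γ : absoluteGaloisGroup K}

/-- **The B17-free direction.** For a dual datum `D` of `𝔖_𝔮(K_∞, M)` with `D.HasCharValuationAt n` (`M` `p`-primary with open stabilisers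
and continuous orbit maps, `M(K_∞)/(γ−1)` finite): **`n ≤ v_p #𝔖_𝔮(K, M) + v_p [𝔖^Γ : res 𝔖_𝔮(K, M)]`** — -w7's identity
`n + v_p #𝔖_Γ + v_p #ker = v_p #𝔖_𝔮(K, M) + v_p [coker]` with the two non-negative terms dropped; NO hypothesis on `𝔖_Γ` (no B17) and none on the
kernel. [cite: GreenbergLNM1716, §4 Lemma 4.2 (p. 102)] [cite: Agboola2007, §5] -/
theorem le_card_base_add_relIndex_of_hasCharValuationAt (D : RestrictedDualData κ M 𝔮 γ)
    (htor : ∀ m : M, ∃ k : ℕ, p ^ k • m = 0)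
    (hstab : ∀ m : M, IsOpen (MulAction.stabilizer (absoluteGaloisGroup K) m : Set (absoluteGaloisGroup K)))
    (hγ : κ.IsTopGenerator γ) (hcont : ∀ m : M, Continuous fun g : absoluteGaloisGroup K ↦ g • m)
    [Finite (FixedPoints.addSubgroup κ.kerSubgroup M ⧸ (subOne κ.kerSubgroup M γ).range)]
    [Module.Finite (IwasawaAlgebra p) D.X] {n : ℕ} (h : D.HasCharValuationAt n) :
    n ≤ padicValNat p (Nat.card (restrictedSelmerBase M p 𝔮)) +
      padicValNat p ((((restrictedSelmerBase M p 𝔮).map (resOfLe M (le_top : κ.kerSubgroup ≤ ⊤))).addSubgroupOf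
        (restrictedSelmerZp κ M 𝔮)).relIndex (endInvariants (conjRestricted κ M 𝔮 γ - 1))) := by
  obtain ⟨-, -, -, -, hid⟩ := hasCharValuationAt_control_identity κ M 𝔮 γ D htor hstab hγ hcont h
  omega

/-- **The B17 direction.** With, in addition, ONE integer `u ≡ 1 (mod p)` such that `u·conj_γ − 1` maps `𝔖_𝔮(K_∞, M)` onto itself (file 1:
then `#𝔖_Γ = 1`): **`v_p #𝔖_𝔮(K, M) + v_p [𝔖^Γ : res] = n + v_p #ker`**, in particular `v_p #𝔖_𝔮(K, M) + v_p [coker] ≤ n + v_p #ker`.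
[cite: GreenbergLNM1716, §4 Lemma 4.2 and pp. 123–125] [cite: Agboola2007, §5 Prop. 5.1] -/
theorem card_base_add_relIndex_eq_of_twistedCoinvariants (D : RestrictedDualData κ M 𝔮 γ)
    (htor : ∀ m : M, ∃ k : ℕ, p ^ k • m = 0)
    (hstab : ∀ m : M, IsOpen (MulAction.stabilizer (absoluteGaloisGroup K) m : Set (absoluteGaloisGroup K)))
    (hγ : κ.IsTopGenerator γ) (hcont : ∀ m : M, Continuous fun g : absoluteGaloisGroup K ↦ g • m)
    [Finite (FixedPoints.addSubgroup κ.kerSubgroup M ⧸ (subOne κ.kerSubgroup M γ).range)]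
    [Module.Finite (IwasawaAlgebra p) D.X] {n : ℕ} (h : D.HasCharValuationAt n)
    {u : ℤ} (hu : (p : ℤ) ∣ u - 1)
    (hsurj : ∀ s : restrictedSelmerZp κ M 𝔮, ∃ t : restrictedSelmerZp κ M 𝔮, u • conjRestricted κ M 𝔮 γ t - t = s) :
    padicValNat p (Nat.card (restrictedSelmerBase M p 𝔮)) +
      padicValNat p ((((restrictedSelmerBase M p 𝔮).map (resOfLe M (le_top : κ.kerSubgroup ≤ ⊤))).addSubgroupOf
        (restrictedSelmerZp κ M 𝔮)).relIndex (endInvariants (conjRestricted κ M 𝔮 γ - 1))) =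
      n + padicValNat p (Nat.card ↥(restrictedSelmerBase M p 𝔮 ⊓ (resOfLe M (le_top : κ.kerSubgroup ≤ ⊤)).ker)) := by
  obtain ⟨-, hfinC, -, -, hid⟩ := hasCharValuationAt_control_identity κ M 𝔮 γ D htor hstab hγ hcont h
  have h1 := natCard_endCoinvariants_eq_one_of_twistedCoinvariants D htor hstab hγ hu hsurj hfinC
  rw [h1, padicValNat_one_right, add_zero] at hid
  omega

end Generic

/-! ## §2. Road α: the sandwich on every S3c₂ frame -/

section Frame

variable {K : Type} [Field K] [NumberField K]

/-- **`n ≤ v₂ #𝔖_{v̄}(K, W*) + v₂ [𝔖^Γ : res 𝔖_{v̄}(K, W*)]` on every S3c₂ frame — B17-FREE, kernel-free, `√−7`-free.** For any elliptic `W/ℚ`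
base-changed to a number field `K`, `π`, `r`, a `ℤ₂`-line `κ'` with generator `γ'`, a place `v̄`, and a finitely generated dual datum `D` of
`𝔖_{v̄}(K*_∞, W*)` (`W* = E[𝔮_r^∞]`) with `D.HasCharValuationAt n`. (LEAD g10's side conditions for the CM summand discharge the finiteness.)
[cite: Agboola2007, §5] [cite: GreenbergLNM1716, §4 Lemma 4.2] -/
theorem eulerChar_le_of_frame (W : WeierstrassCurve ℚ) [W.IsElliptic] (π : (W.baseChange K).endRing) (r : ℤ_[2])
    (κ' : ZpExtension K 2) {γ' : absoluteGaloisGroup K} (hγ' : κ'.IsTopGenerator γ') (vbar : HeightOneSpectrum (𝓞 K))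
    (D : RestrictedDualData κ' ↥((W.baseChange K).endEigenPrimaryTorsion 2 π r) vbar γ')
    [Module.Finite (IwasawaAlgebra 2) D.X] {n : ℕ} (hD : D.HasCharValuationAt n) :
    n ≤ padicValNat 2 (Nat.card (restrictedSelmerBase ↥((W.baseChange K).endEigenPrimaryTorsion 2 π r) 2 vbar)) +
      padicValNat 2 ((((restrictedSelmerBase ↥((W.baseChange K).endEigenPrimaryTorsion 2 π r) 2 vbar).map
          (resOfLe ↥((W.baseChange K).endEigenPrimaryTorsion 2 π r) (le_top : κ'.kerSubgroup ≤ ⊤))).addSubgroupOf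
          (restrictedSelmerZp κ' ↥((W.baseChange K).endEigenPrimaryTorsion 2 π r) vbar)).relIndex
        (endInvariants (conjRestricted κ' ↥((W.baseChange K).endEigenPrimaryTorsion 2 π r) vbar γ' - 1))) := by
  haveI : (W.baseChange K).IsElliptic := by rw [baseChange]; infer_instance
  obtain ⟨-, -, -, -, hid⟩ :=
    hasCharValuationAt_control_identity_endEigenPrimaryTorsion (W.baseChange K) 2 π r κ' hγ' vbar D hD
  omega

/-- **`n ≤ v₂ #𝔖_{v̄}(K, W*) + #T + 2` on every S3c₂ frame, `T` = the places of `K` above the odd part of `7d` — the CLASS-UNIFORM upper bound for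
the Euler characteristic, B17-FREE and B15-free** (§1 + -w3 g7's `padicValNat_two_relIndex_control_of_frame_le`). Member `C • W = cm7^{(d)}`,
`d ≠ 0` squarefree, `K` imaginary quadratic, `v ≠ v̄` over `2`, `π² = π − 2`, `r² = r − 2`, `κ'` unramified outside `v̄`. This is the S3c₂ input
of the LOWER half of the crux (`MissingLowerBoundAt`), modulo the bottom value `v₂ #𝔖_{v̄}(K, W*)`.
[cite: Agboola2007, §3 Prop. 3.2, §5, §6] [cite: GreenbergLNM1716, §3, §4 Lemma 4.2] -/
theorem eulerChar_le_card_base_add_card_add_two_of_frame {d : ℤ} (hd0 : d ≠ 0) (hsq : Squarefree d)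
    (W : WeierstrassCurve ℚ) [W.IsElliptic] (C : VariableChange ℚ) (hC : C • W = cm7.quadraticTwist (d : ℚ))
    (hK : IsImaginaryQuadratic K) {v vbar : HeightOneSpectrum (𝓞 K)} (hv : ((2 : ℕ) : 𝓞 K) ∈ v.asIdeal)
    (hvbar : ((2 : ℕ) : 𝓞 K) ∈ vbar.asIdeal) (hne : vbar ≠ v) (π : (W.baseChange K).endRing)
    (hrel : (π : AddMonoid.End (W.baseChange K).geomPoints) * π = π - 2) {r : ℤ_[2]} (hr : r * r = r - 2)
    (κ' : ZpExtension K 2) (hκ' : κ'.IsUnramifiedOutside vbar) {γ' : absoluteGaloisGroup K} (hγ' : κ'.IsTopGenerator γ')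
    (T : Finset (HeightOneSpectrum (𝓞 K)))
    (hT : ∀ w : HeightOneSpectrum (𝓞 K), w ∈ T ↔ ((2 : ℕ) : 𝓞 K) ∉ w.asIdeal ∧ ((7 * d : ℤ) : 𝓞 K) ∈ w.asIdeal)
    (D : RestrictedDualData κ' ↥((W.baseChange K).endEigenPrimaryTorsion 2 π r) vbar γ')
    [Module.Finite (IwasawaAlgebra 2) D.X] {n : ℕ} (hD : D.HasCharValuationAt n) :
    n ≤ padicValNat 2 (Nat.card (restrictedSelmerBase ↥((W.baseChange K).endEigenPrimaryTorsion 2 π r) 2 vbar)) + (T.card + 2) := by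
  have h1 := eulerChar_le_of_frame W π r κ' hγ' vbar D hD
  have h2 := padicValNat_two_relIndex_control_of_frame_le hd0 hsq W C hC hK hv hvbar hne π hrel hr κ' hκ' hγ' T hT
  omega

/-- **`v₂ #𝔖_{v̄}(K, W*) + v₂ [coker] ≤ n + 1` on every S3c₂ frame over `K ∋ √−7`, GIVEN B17** (in file 1's form: one odd `u` with
`u·conj_{γ'} − 1` onto `𝔖_{v̄}(K*_∞, W*)`) — LEAD g11's collapsed identity (`n + v₂ #ker = …`, `v₂ #ker ≤ 1`). This is the direction of the UPPER
half of the crux (`MissingUpperBoundAt`), and the ONLY place where «no nonzero finite `Λ`-submodule» is used.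
[cite: Agboola2007, §5 Prop. 5.1] [cite: GreenbergLNM1716, §4 Props. 4.14–4.15] -/
theorem card_base_add_relIndex_le_eulerChar_add_one_of_frame_of_twistedCoinvariants {d : ℤ} (hd0 : d ≠ 0)
    (W : WeierstrassCurve ℚ) [W.IsElliptic] (C : VariableChange ℚ) (hC : C • W = cm7.quadraticTwist (d : ℚ))
    (hK : IsImaginaryQuadratic K) {θ : K} (hθ : θ ^ 2 = -7)
    (vbar : HeightOneSpectrum (𝓞 K)) (hvbar : ((2 : ℕ) : 𝓞 K) ∈ vbar.asIdeal)
    (π : (W.baseChange K).endRing) (hrel : (π : AddMonoid.End (W.baseChange K).geomPoints) * π = π - 2)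
    {r : ℤ_[2]} (hr : r * r = r - 2) (κ' : ZpExtension K 2) (hκ' : κ'.IsUnramifiedOutside vbar)
    {γ' : absoluteGaloisGroup K} (hγ' : κ'.IsTopGenerator γ')
    (D : RestrictedDualData κ' ↥((W.baseChange K).endEigenPrimaryTorsion 2 π r) vbar γ')
    [Module.Finite (IwasawaAlgebra 2) D.X] {n : ℕ} (hD : D.HasCharValuationAt n)
    {u : ℤ} (hu : (2 : ℤ) ∣ u - 1)
    (hsurj : ∀ s : restrictedSelmerZp κ' ↥((W.baseChange K).endEigenPrimaryTorsion 2 π r) vbar,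
      ∃ t : restrictedSelmerZp κ' ↥((W.baseChange K).endEigenPrimaryTorsion 2 π r) vbar,
        u • conjRestricted κ' ↥((W.baseChange K).endEigenPrimaryTorsion 2 π r) vbar γ' t - t = s) :
    padicValNat 2 (Nat.card (restrictedSelmerBase ↥((W.baseChange K).endEigenPrimaryTorsion 2 π r) 2 vbar)) +
      padicValNat 2 ((((restrictedSelmerBase ↥((W.baseChange K).endEigenPrimaryTorsion 2 π r) 2 vbar).map
          (resOfLe ↥((W.baseChange K).endEigenPrimaryTorsion 2 π r) (le_top : κ'.kerSubgroup ≤ ⊤))).addSubgroupOf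
          (restrictedSelmerZp κ' ↥((W.baseChange K).endEigenPrimaryTorsion 2 π r) vbar)).relIndex
        (endInvariants (conjRestricted κ' ↥((W.baseChange K).endEigenPrimaryTorsion 2 π r) vbar γ' - 1))) ≤ n + 1 := by
  obtain ⟨-, hker, hid⟩ := control_identity_of_frame_of_twistedCoinvariants hd0 W C hC hK hθ vbar hvbar π hrel hr κ' hκ' hγ' D hD
    hu hsurj
  omega

/-- **THE SANDWICH on every S3c₂ frame over `K = ℚ(√−7)`:** `v₂ #𝔖_{v̄}(K, W*) − 1 ≤ n ≤ v₂ #𝔖_{v̄}(K, W*) + #T + 2`, the left inequality GIVEN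
B17 (twisted surjectivity for one odd `u`), the right one unconditionally; `T` = places of `K` above the odd part of `7d`. What S3c₂ asserts
beyond this sandwich is the EXACT value, which needs the bottom value `v₂ #𝔖_{v̄}(K, W*)` (Agboola §6 / Prop. 8.1) and the exact local terms
(B15). [cite: Agboola2007, §5 Prop. 5.1, §6, Prop. 8.1] [cite: GreenbergLNM1716, §4 Lemma 4.2, Props. 4.14–4.15] -/
theorem eulerChar_sandwich_of_frame {d : ℤ} (hd0 : d ≠ 0) (hsq : Squarefree d)
    (W : WeierstrassCurve ℚ) [W.IsElliptic] (C : VariableChange ℚ) (hC : C • W = cm7.quadraticTwist (d : ℚ))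
    (hK : IsImaginaryQuadratic K) {θ : K} (hθ : θ ^ 2 = -7) {v vbar : HeightOneSpectrum (𝓞 K)}
    (hv : ((2 : ℕ) : 𝓞 K) ∈ v.asIdeal) (hvbar : ((2 : ℕ) : 𝓞 K) ∈ vbar.asIdeal) (hne : vbar ≠ v)
    (π : (W.baseChange K).endRing) (hrel : (π : AddMonoid.End (W.baseChange K).geomPoints) * π = π - 2)
    {r : ℤ_[2]} (hr : r * r = r - 2) (κ' : ZpExtension K 2) (hκ' : κ'.IsUnramifiedOutside vbar)
    {γ' : absoluteGaloisGroup K} (hγ' : κ'.IsTopGenerator γ')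
    (T : Finset (HeightOneSpectrum (𝓞 K)))
    (hT : ∀ w : HeightOneSpectrum (𝓞 K), w ∈ T ↔ ((2 : ℕ) : 𝓞 K) ∉ w.asIdeal ∧ ((7 * d : ℤ) : 𝓞 K) ∈ w.asIdeal)
    (D : RestrictedDualData κ' ↥((W.baseChange K).endEigenPrimaryTorsion 2 π r) vbar γ')
    [Module.Finite (IwasawaAlgebra 2) D.X] {n : ℕ} (hD : D.HasCharValuationAt n)
    {u : ℤ} (hu : (2 : ℤ) ∣ u - 1)
    (hsurj : ∀ s : restrictedSelmerZp κ' ↥((W.baseChange K).endEigenPrimaryTorsion 2 π r) vbar,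
      ∃ t : restrictedSelmerZp κ' ↥((W.baseChange K).endEigenPrimaryTorsion 2 π r) vbar,
        u • conjRestricted κ' ↥((W.baseChange K).endEigenPrimaryTorsion 2 π r) vbar γ' t - t = s) :
    padicValNat 2 (Nat.card (restrictedSelmerBase ↥((W.baseChange K).endEigenPrimaryTorsion 2 π r) 2 vbar)) ≤ n + 1 ∧
      n ≤ padicValNat 2 (Nat.card (restrictedSelmerBase ↥((W.baseChange K).endEigenPrimaryTorsion 2 π r) 2 vbar)) + (T.card + 2) := by
  have h1 := card_base_add_relIndex_le_eulerChar_add_one_of_frame_of_twistedCoinvariants hd0 W C hC hK hθ vbar hvbar π hrel hr κ'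
    hκ' hγ' D hD hu hsurj
  have h2 := eulerChar_le_card_base_add_card_add_two_of_frame hd0 hsq W C hC hK hv hvbar hne π hrel hr κ' hκ' hγ' T hT D hD
  exact ⟨by omega, h2⟩

end Frame

end Summit.BirchSwinnertonDyer.BirchSwinnertonDyer.Theorems.PrintCf2.RestrictedSelmerPair

end
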